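import Mathlib
import HarnessLib
import Summits.NavierStokesRegularity.NavierStokesRegularity.Theorems.PoloidalWindowDoorLrcModEntireCurvedWebHuygens

/-!
# Route `PoloidalWindowDoor`, item `LrcModEntire` (stmt-NavierStokesRegularity-20428), cell (Q4-sonic, curved branch) of the (TH) column —
# THE TRANSPORT LAW ON A CHARACTERISTIC CURVED SHEET: `(1 − d(z)k(s))·d′(z)·(∂_ν²θ)²` is constant along the height

Cell ns-regularity-ideate, stub-worker seat ns-poloidal-K2-p2 g16 under the LEAD of item 20428 (ns-poloidal-K2-p3 g16);
`--supports stmt-NavierStokesRegularity-20428 --as helper`.  Memo `Cruxes/LrcModEntire/T2B-g16-sonic.md` v2 §5 (LEAD's Fermi–shear derivation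
`∂_z((1 − d(z)k(s))·d′(z)·a₂(s,z)²) = 0`); the ¬line analogue of LEAD's `…SheetTransport.transport_on_characteristic_sheet`, proved FRAME-FREE in `ℝ³`
(no flattened coordinates): third derivatives of `θ` along the parallel web `W(s,z) = Γ(s) + d(z)·JΓ′(s) + z·e₂`.

Setting (class-free): `θ : ℝ³ → ℝ` smooth with the slice law `∂₂²θ = −μ(x₂)Δₕθ` on the slab `{x₂ ∈ I}`; `Γ` a `C²` unit-speed branch in `P₀` with Frenet law
`Γ″ = k•JΓ′`; `d` smooth on `I`; the web points `W(s,z)` horizontally critical for `θ` (`∂_{JΓ′}θ(W) = ∂_{Γ′}θ(W) = 0`, all `s`, `z ∈ I`); and the sheet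
CHARACTERISTIC, `d′(z)² + μ(z) = 0` on `I`.  With `T = Γ′(s)`, `ν = JΓ′(s)`, `B = D²θ(W)`, `a₂ = B[ν,ν]`, `J = 1 − d k(s)`:
* `∂_s(∂_νθ(W)) = 0` ⇒ `B[T,ν] = 0`; `∂_s(∂_Tθ(W)) = 0` ⇒ `B[T,T] = 0` (turning terms die by the other identity); `∂_s(B[T,ν]) = 0` ⇒ `J·D³θ[T,T,ν] = −k a₂`;
* `∂_z(∂_νθ(W)) = 0` twice ⇒ `d″a₂ + d′²D³θ[ν,ν,ν] + 2d′D³θ[e₂,ν,ν] + D³θ[e₂,e₂,ν] = 0`; `∂_za₂ = d′D³θ[ν,ν,ν] + D³θ[e₂,ν,ν]`;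
* `∂_ν` of the slice law at `W` + frame invariance of the trace: `D³θ[ν,e₂,e₂] + μ(D³θ[ν,T,T] + D³θ[ν,ν,ν]) = 0`;
whence `J(2d′∂_za₂ + d″a₂) = J(d′²+μ)D³θ[ν,ν,ν] − μk a₂ = −μk a₂` and

  ★ `curved_transport_on_characteristic_sheet`: `HasDerivAt (z ↦ (1 − d z·k s)·d′(z)·(D²θ(W(s,z))[JΓ′ s][JΓ′ s])²) 0 z`  (every `s`, `z ∈ I`).

Use (cell (Q4-sonic), curved branch; next file): with parallel webs (`…CurvedWebPackage`) and the ridge law `a₂ = −κf(z)`, the conserved quantity is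
`(1 − d(z)k(s))·d′(z)·κf(z)²`; `μ(−1,0) = 0` forces `d′ ≡ 0` (then `μ ≡ 0`, vertical-shear germ), and `μ(−1,0) < 0` forces `k` CONSTANT in `s`, i.e. `Γ` a line
(`…PlanarCurveRigidity` + `…Q4LimitBranchProper`) — against the cell literal `¬ line`.
WHAT THIS IS NOT: not a claim about Navier–Stokes regularity; class-free calculus (bears_on LADDER-NS N0 via item 20428; items 20428 / 19708 / 27893 OPEN).
-/

noncomputable section

-- the summit and its single sub-problem share the name (CONVENTIONS §1), as in every Theorems file
set_option linter.dupNamespace false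

namespace Summit.NavierStokesRegularity.NavierStokesRegularity.Theorems.PoloidalWindowDoorLrcModEntireCurvedSheetTransport

open Set Function Filter Topology
open scoped InnerProductSpace RealInnerProductSpace ContDiff
open Summit.NavierStokesRegularity.NavierStokesRegularity.Theorems.PoloidalWindowDoorLrcModEntireSheetFlattenTools
open Summit.NavierStokesRegularity.NavierStokesRegularity.Theorems.PoloidalWindowDoorLrcModEntireParallelWebsIdentity
open Summit.NavierStokesRegularity.NavierStokesRegularity.Theorems.PoloidalWindowDoorLrcModEntireRidgeGlobalBranchODE
open Summit.NavierStokesRegularity.NavierStokesRegularity.Theorems.PoloidalWindowDoorLrcModEntireRidgeGlobalBranchFrame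
open Summit.NavierStokesRegularity.NavierStokesRegularity.Theorems.PoloidalWindowDoorLrcModEntirePlanarCurveRigidity
open Summit.NavierStokesRegularity.NavierStokesRegularity.Theorems.PoloidalWindowDoorLrcModEntireCurvedWebHuygens

/-! ### A. Third-derivative calculus: slot symmetries and the moving second derivative -/

section calculus

variable {θ : EuclideanSpace ℝ (Fin 3) → ℝ}

/-- Swap of the first two slots of `D³θ`. -/
theorem fderiv3_swap12 (hθ : ContDiff ℝ 3 θ) (x a b c : EuclideanSpace ℝ (Fin 3)) :
    fderiv ℝ (fderiv ℝ (fderiv ℝ θ)) x a b c = fderiv ℝ (fderiv ℝ (fderiv ℝ θ)) x b a c := by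
  rw [fderiv3_eq_iteratedFDeriv hθ, fderiv3_eq_iteratedFDeriv hθ]
  have h := Literature.Analysis.Calculus.iteratedFDeriv_apply_perm_of_le (hθ.contDiffAt (x := x)) le_rfl ![a, b, c] (Equiv.swap 0 1)
  have hv : (fun i => (![a, b, c] : Fin 3 → EuclideanSpace ℝ (Fin 3)) ((Equiv.swap (0 : Fin 3) 1) i)) = ![b, a, c] := by
    funext i; fin_cases i <;> simp [Equiv.swap_apply_of_ne_of_ne]
  rw [hv] at h
  exact h.symm

/-- Swap of the last two slots of `D³θ`. -/
theorem fderiv3_swap23 (hθ : ContDiff ℝ 3 θ) (x a b c : EuclideanSpace ℝ (Fin 3)) :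
    fderiv ℝ (fderiv ℝ (fderiv ℝ θ)) x a b c = fderiv ℝ (fderiv ℝ (fderiv ℝ θ)) x a c b := by
  rw [fderiv3_eq_iteratedFDeriv hθ, fderiv3_eq_iteratedFDeriv hθ]
  have h := Literature.Analysis.Calculus.iteratedFDeriv_apply_perm_of_le (hθ.contDiffAt (x := x)) le_rfl ![a, b, c] (Equiv.swap 1 2)
  have hv : (fun i => (![a, b, c] : Fin 3 → EuclideanSpace ℝ (Fin 3)) ((Equiv.swap (1 : Fin 3) 2) i)) = ![a, c, b] := by
    funext i; fin_cases i <;> simp [Equiv.swap_apply_of_ne_of_ne]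
  rw [hv] at h
  exact h.symm

/-- The derivative of `x ↦ D²θ(x)[b][c]` in the direction `a` is `D³θ(x)[a][b][c]`. -/
theorem fderiv_hessian_apply_const (hθ : ContDiff ℝ 3 θ) (x a b c : EuclideanSpace ℝ (Fin 3)) :
    fderiv ℝ (fun y => fderiv ℝ (fderiv ℝ θ) y b c) x a = fderiv ℝ (fderiv ℝ (fderiv ℝ θ)) x a b c := by
  have hD2c : ContDiff ℝ 1 (fderiv ℝ (fderiv ℝ θ)) := (hθ.fderiv_right (m := 2) (by norm_cast)).fderiv_right (m := 1) (by norm_cast)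
  have hD2 := hD2c.differentiable one_ne_zero x
  have hD2b : DifferentiableAt ℝ (fun y => fderiv ℝ (fderiv ℝ θ) y b) x := hD2.clm_apply (differentiableAt_const b)
  rw [fderiv_clm_apply hD2b (differentiableAt_const c), fderiv_clm_apply hD2 (differentiableAt_const b)]
  simp

variable {Γ : ℝ → EuclideanSpace ℝ (Fin 3)} {k : ℝ → ℝ} {G : ℝ × ℝ → ℝ}

/-- **Derivative of a MOVING second derivative along the curved web**: for `θ ∈ C³` and frame fields `V₁, V₂` of `s` with derivatives `V₁′, V₂′`,
`D(q ↦ D²θ(W q)[V₁(q₁)][V₂(q₁)])[h] = D³θ(W)[DW h][V₁][V₂] + h₁·(D²θ(W)[V₁′][V₂] + D²θ(W)[V₁][V₂′])`. -/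
theorem fderiv_moving_hessian (hΓ : ContDiff ℝ 2 Γ) (hpl : ∀ s, Γ s 2 = 0)
    (hk : ∀ s, deriv (deriv Γ) s = k s • rotJ (deriv Γ s)) {p : ℝ × ℝ} (hG : DifferentiableAt ℝ G p)
    (hθ : ContDiff ℝ 3 θ) {V₁ V₂ : ℝ → EuclideanSpace ℝ (Fin 3)} {V₁' V₂' : EuclideanSpace ℝ (Fin 3)}
    (hV₁ : HasDerivAt V₁ V₁' p.1) (hV₂ : HasDerivAt V₂ V₂' p.1) (h : ℝ × ℝ) :
    fderiv ℝ (fun q : ℝ × ℝ => fderiv ℝ (fderiv ℝ θ) (Γ q.1 + G q • rotJ (deriv Γ q.1) + q.2 • e2) (V₁ q.1) (V₂ q.1)) p h =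
      fderiv ℝ (fderiv ℝ (fderiv ℝ θ)) (Γ p.1 + G p • rotJ (deriv Γ p.1) + p.2 • e2)
          ((h.1 * (1 - k p.1 * G p)) • deriv Γ p.1 + fderiv ℝ G p h • rotJ (deriv Γ p.1) + h.2 • e2) (V₁ p.1) (V₂ p.1) +
        h.1 * (fderiv ℝ (fderiv ℝ θ) (Γ p.1 + G p • rotJ (deriv Γ p.1) + p.2 • e2) V₁' (V₂ p.1) +
          fderiv ℝ (fderiv ℝ θ) (Γ p.1 + G p • rotJ (deriv Γ p.1) + p.2 • e2) (V₁ p.1) V₂') := by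
  set W : ℝ × ℝ → EuclideanSpace ℝ (Fin 3) := fun q => Γ q.1 + G q • rotJ (deriv Γ q.1) + q.2 • e2 with hW
  have hD2c : ContDiff ℝ 1 (fderiv ℝ (fderiv ℝ θ)) := (hθ.fderiv_right (m := 2) (by norm_cast)).fderiv_right (m := 1) (by norm_cast)
  have hD2 := hD2c.differentiable one_ne_zero
  have hWd : DifferentiableAt ℝ W p := differentiableAt_curvedWeb hΓ hpl hk hG
  have hc : DifferentiableAt ℝ (fun q => fderiv ℝ (fderiv ℝ θ) (W q)) p := (hD2 (W p)).comp p hWd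
  have hV₁q : HasFDerivAt (fun q : ℝ × ℝ => V₁ q.1) ((ContinuousLinearMap.smulRight (1 : ℝ →L[ℝ] ℝ) V₁').comp (ContinuousLinearMap.fst ℝ ℝ ℝ)) p :=
    hV₁.hasFDerivAt.comp p hasFDerivAt_fst
  have hV₂q : HasFDerivAt (fun q : ℝ × ℝ => V₂ q.1) ((ContinuousLinearMap.smulRight (1 : ℝ →L[ℝ] ℝ) V₂').comp (ContinuousLinearMap.fst ℝ ℝ ℝ)) p :=
    hV₂.hasFDerivAt.comp p hasFDerivAt_fst
  have hu₁ : DifferentiableAt ℝ (fun q : ℝ × ℝ => V₁ q.1) p := hV₁q.differentiableAt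
  have hu₂ : DifferentiableAt ℝ (fun q : ℝ × ℝ => V₂ q.1) p := hV₂q.differentiableAt
  have hg : DifferentiableAt ℝ (fun q => fderiv ℝ (fderiv ℝ θ) (W q) (V₁ q.1)) p := hc.clm_apply hu₁
  rw [fderiv_clm_apply hg hu₂]
  simp only [_root_.add_apply, ContinuousLinearMap.comp_apply, ContinuousLinearMap.flip_apply]
  rw [hV₂q.fderiv, fderiv_clm_apply hc hu₁]
  simp only [_root_.add_apply, ContinuousLinearMap.comp_apply, ContinuousLinearMap.flip_apply]
  rw [hV₁q.fderiv]
  have hcW : fderiv ℝ (fun q => fderiv ℝ (fderiv ℝ θ) (W q)) p h = fderiv ℝ (fderiv ℝ (fderiv ℝ θ)) (W p) (fderiv ℝ W p h) := by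
    rw [show (fun q => fderiv ℝ (fderiv ℝ θ) (W q)) = fderiv ℝ (fderiv ℝ θ) ∘ W from rfl, fderiv_comp p (hD2 (W p)) hWd]
    rfl
  rw [hcW, hW, fderiv_curvedWeb_apply hΓ hpl hk hG h]
  simp only [ContinuousLinearMap.comp_apply, ContinuousLinearMap.coe_fst', ContinuousLinearMap.smulRight_apply,
    ContinuousLinearMap.one_def, ContinuousLinearMap.id_apply, map_smul, smul_eq_mul, _root_.smul_apply]
  ring

/-- Differentiability of the moving second derivative `q ↦ D²θ(W q)[V₁(q₁)][V₂(q₁)]`. -/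
theorem differentiableAt_moving_hessian (hΓ : ContDiff ℝ 2 Γ) (hpl : ∀ s, Γ s 2 = 0)
    (hk : ∀ s, deriv (deriv Γ) s = k s • rotJ (deriv Γ s)) {p : ℝ × ℝ} (hG : DifferentiableAt ℝ G p)
    (hθ : ContDiff ℝ 3 θ) {V₁ V₂ : ℝ → EuclideanSpace ℝ (Fin 3)} {V₁' V₂' : EuclideanSpace ℝ (Fin 3)}
    (hV₁ : HasDerivAt V₁ V₁' p.1) (hV₂ : HasDerivAt V₂ V₂' p.1) :
    DifferentiableAt ℝ (fun q : ℝ × ℝ => fderiv ℝ (fderiv ℝ θ) (Γ q.1 + G q • rotJ (deriv Γ q.1) + q.2 • e2) (V₁ q.1) (V₂ q.1)) p := by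
  have hD2c : ContDiff ℝ 1 (fderiv ℝ (fderiv ℝ θ)) := (hθ.fderiv_right (m := 2) (by norm_cast)).fderiv_right (m := 1) (by norm_cast)
  have hD2 := hD2c.differentiable one_ne_zero
  have hWd := differentiableAt_curvedWeb hΓ hpl hk hG
  have hu₁ : DifferentiableAt ℝ (fun q : ℝ × ℝ => V₁ q.1) p := (hV₁.hasFDerivAt.comp p hasFDerivAt_fst).differentiableAt
  have hu₂ : DifferentiableAt ℝ (fun q : ℝ × ℝ => V₂ q.1) p := (hV₂.hasFDerivAt.comp p hasFDerivAt_fst).differentiableAt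
  have hc : DifferentiableAt ℝ (fun q : ℝ × ℝ => fderiv ℝ (fderiv ℝ θ) (Γ q.1 + G q • rotJ (deriv Γ q.1) + q.2 • e2)) p :=
    (hD2 _).comp p hWd
  exact (hc.clm_apply hu₁).clm_apply hu₂

end calculus

/-! ### B. The transport law -/

/-- ★ **THE TRANSPORT LAW ON A CHARACTERISTIC CURVED SHEET.**  See the module docstring. -/
theorem curved_transport_on_characteristic_sheet {θ : EuclideanSpace ℝ (Fin 3) → ℝ} (hθ : ContDiff ℝ ∞ θ)
    {I : Set ℝ} (hI : IsOpen I) {μ d : ℝ → ℝ} (hμ : ∀ z ∈ I, DifferentiableAt ℝ μ z) (hd : ContDiffOn ℝ ∞ d I)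
    {Γ : ℝ → EuclideanSpace ℝ (Fin 3)} (hΓ : ContDiff ℝ 2 Γ) (hpl : ∀ s, Γ s 2 = 0) (hun : ∀ s, ‖deriv Γ s‖ = 1)
    {k : ℝ → ℝ} (hk : ∀ s, deriv (deriv Γ) s = k s • rotJ (deriv Γ s))
    (hJ : ∀ s : ℝ, ∀ z ∈ I, 1 - k s * d z ≠ 0)
    (hlaw : ∀ x : EuclideanSpace ℝ (Fin 3), x 2 ∈ I →
      fderiv ℝ (fun y => fderiv ℝ θ y (EuclideanSpace.single 2 (1 : ℝ))) x (EuclideanSpace.single 2 (1 : ℝ)) =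
        -μ (x 2) * (fderiv ℝ (fun y => fderiv ℝ θ y (EuclideanSpace.single 0 (1 : ℝ))) x (EuclideanSpace.single 0 (1 : ℝ)) +
          fderiv ℝ (fun y => fderiv ℝ θ y (EuclideanSpace.single 1 (1 : ℝ))) x (EuclideanSpace.single 1 (1 : ℝ))))
    (hν : ∀ s : ℝ, ∀ z ∈ I, fderiv ℝ θ (Γ s + d z • rotJ (deriv Γ s) + z • e2) (rotJ (deriv Γ s)) = 0)
    (hT : ∀ s : ℝ, ∀ z ∈ I, fderiv ℝ θ (Γ s + d z • rotJ (deriv Γ s) + z • e2) (deriv Γ s) = 0)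
    (hQ0 : ∀ z ∈ I, deriv d z ^ 2 + μ z = 0) (s : ℝ) {z : ℝ} (hz : z ∈ I) :
    HasDerivAt (fun z' : ℝ => (1 - k s * d z') * deriv d z' *
      (fderiv ℝ (fderiv ℝ θ) (Γ s + d z' • rotJ (deriv Γ s) + z' • e2) (rotJ (deriv Γ s)) (rotJ (deriv Γ s))) ^ 2) 0 z := by
  -- smoothness
  have hθ3 : ContDiff ℝ 3 θ := hθ.of_le (by norm_cast)
  have hθ2 : ContDiff ℝ 2 θ := hθ.of_le (by norm_cast)
  have hθd : Differentiable ℝ θ := hθ.differentiable (by simp)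
  have hD2c : ContDiff ℝ 1 (fderiv ℝ (fderiv ℝ θ)) := (hθ3.fderiv_right (m := 2) (by norm_cast)).fderiv_right (m := 1) (by norm_cast)
  have hD2 := hD2c.differentiable one_ne_zero
  have hsymm2 : ∀ x u v, fderiv ℝ (fderiv ℝ θ) x u v = fderiv ℝ (fderiv ℝ θ) x v u := fun x u v =>
    (hθ2.contDiffAt.isSymmSndFDerivAt (by simp)) u v
  -- derivatives of `d`
  have hdd : ∀ z ∈ I, DifferentiableAt ℝ d z := fun z hz => (hd.contDiffAt (hI.mem_nhds hz)).differentiableAt (by simp)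
  have hd1 : ContDiffOn ℝ ∞ (deriv d) I := hd.deriv_of_isOpen hI (m := ∞) (by simp)
  have hdd1 : ∀ z ∈ I, DifferentiableAt ℝ (deriv d) z := fun z hz => (hd1.contDiffAt (hI.mem_nhds hz)).differentiableAt (by simp)
  -- the web as a curved web map with `G q = d q.2`, on the region `ℝ × I`
  set Gd : ℝ × ℝ → ℝ := fun q => d q.2 with hGd
  have hGdd : ∀ q ∈ region I, DifferentiableAt ℝ Gd q := fun q hq => (hdd q.2 hq).comp q differentiableAt_snd
  have hGd_fd : ∀ q ∈ region I, ∀ h : ℝ × ℝ, fderiv ℝ Gd q h = deriv d q.2 * h.2 := fun q hq h => by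
    rw [hGd, show (fun q : ℝ × ℝ => d q.2) = d ∘ Prod.snd from rfl, fderiv_comp q (hdd q.2 hq) differentiableAt_snd]
    simp [fderiv_snd, mul_comm]
  have hd'q : ∀ q ∈ region I, HasFDerivAt (fun q : ℝ × ℝ => deriv d q.2)
      ((ContinuousLinearMap.smulRight (1 : ℝ →L[ℝ] ℝ) (deriv (deriv d) q.2)).comp (ContinuousLinearMap.snd ℝ ℝ ℝ)) q := fun q hq =>
    (hdd1 q.2 hq).hasDerivAt.hasFDerivAt.comp q hasFDerivAt_snd
  -- frame facts
  have hT2s : ∀ s, deriv Γ s 2 = 0 := fun s => (deriv_horizontal hΓ hpl s).1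
  have hν2s : ∀ s, rotJ (deriv Γ s) 2 = 0 := fun s => (rotJ_facts (hT2s s) (hun s)).1
  have hTd : ∀ s, HasDerivAt (deriv Γ) (k s • rotJ (deriv Γ s)) s := fun s => by
    have h := (hasDerivAt_of_contDiff_two hΓ s).2; rwa [hk s] at h
  have hNd : ∀ s, HasDerivAt (fun t => rotJ (deriv Γ t)) (-(k s) • deriv Γ s) s := hasDerivAt_normal hΓ hpl hk
  -- the web identities in the curved-web-map currency on the region
  have hνW : ∀ q ∈ region I, fderiv ℝ θ (Γ q.1 + Gd q • rotJ (deriv Γ q.1) + q.2 • e2) (rotJ (deriv Γ q.1)) = 0 :=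
    fun q hq => hν q.1 q.2 hq
  have hTW : ∀ q ∈ region I, fderiv ℝ θ (Γ q.1 + Gd q • rotJ (deriv Γ q.1) + q.2 • e2) (deriv Γ q.1) = 0 :=
    fun q hq => hT q.1 q.2 hq
  /- (1) `B[T,ν] = 0` and `B[T,T] = 0` on the region. -/
  have hBTν : ∀ q ∈ region I, fderiv ℝ (fderiv ℝ θ) (Γ q.1 + Gd q • rotJ (deriv Γ q.1) + q.2 • e2) (deriv Γ q.1) (rotJ (deriv Γ q.1)) = 0 := by
    intro q hq
    have h := fderiv_eq_zero_of_eqOn_region hI hνW hq (1, 0)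
    rw [fderiv_moving_deriv hΓ hpl hk (hGdd q hq) hθ2 (hNd q.1), hGd_fd q hq] at h
    have hT0q := hTW q hq
    simp only [map_smul, _root_.smul_apply, smul_eq_mul, mul_zero, zero_smul, add_zero, one_mul] at h
    have hkey : (1 - k q.1 * Gd q) * fderiv ℝ (fderiv ℝ θ) (Γ q.1 + Gd q • rotJ (deriv Γ q.1) + q.2 • e2) (deriv Γ q.1)
        (rotJ (deriv Γ q.1)) = 0 := by linear_combination h + k q.1 * hT0q
    rcases mul_eq_zero.1 hkey with h1 | h1
    · exact absurd h1 (hJ q.1 q.2 hq)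
    · exact h1
  have hBTT : ∀ q ∈ region I, fderiv ℝ (fderiv ℝ θ) (Γ q.1 + Gd q • rotJ (deriv Γ q.1) + q.2 • e2) (deriv Γ q.1) (deriv Γ q.1) = 0 := by
    intro q hq
    have h := fderiv_eq_zero_of_eqOn_region hI hTW hq (1, 0)
    rw [fderiv_moving_deriv hΓ hpl hk (hGdd q hq) hθ2 (hTd q.1), hGd_fd q hq] at h
    have hν0q := hνW q hq
    simp only [map_smul, _root_.smul_apply, smul_eq_mul, mul_zero, zero_smul, add_zero, one_mul] at h
    have hkey : (1 - k q.1 * Gd q) * fderiv ℝ (fderiv ℝ θ) (Γ q.1 + Gd q • rotJ (deriv Γ q.1) + q.2 • e2) (deriv Γ q.1)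
        (deriv Γ q.1) = 0 := by
      linear_combination h - k q.1 * hν0q
    rcases mul_eq_zero.1 hkey with h1 | h1
    · exact absurd h1 (hJ q.1 q.2 hq)
    · exact h1
  -- notation at the point
  set p : ℝ × ℝ := (s, z) with hp_def
  have hp : p ∈ region I := hz
  set x : EuclideanSpace ℝ (Fin 3) := Γ s + d z • rotJ (deriv Γ s) + z • e2 with hx
  set T : EuclideanSpace ℝ (Fin 3) := deriv Γ s with hTdef
  set ν : EuclideanSpace ℝ (Fin 3) := rotJ (deriv Γ s) with hνdef
  set B := fderiv ℝ (fderiv ℝ θ) x with hB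
  set D := fderiv ℝ (fderiv ℝ (fderiv ℝ θ)) x with hD
  set J : ℝ := 1 - k s * d z with hJdef
  have hJp : 1 - k p.1 * Gd p = J := by simp [hJdef, hp_def, hGd]
  have hxW : Γ p.1 + Gd p • rotJ (deriv Γ p.1) + p.2 • e2 = x := by simp [hx, hp_def, hGd, hνdef]
  /- (2) `J·D³θ[T,T,ν] = −k·B[ν,ν]` at the point (second `s`-derivative). -/
  have hE1 : J * D ν T T + k s * B ν ν = 0 := by
    have h := fderiv_eq_zero_of_eqOn_region hI hBTν hp (1, 0)
    rw [fderiv_moving_hessian hΓ hpl hk (hGdd p hp) hθ3 (hTd p.1) (hNd p.1), hGd_fd p hp, hxW, hJp] at h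
    have hTT0 : B T T = 0 := by have := hBTT p hp; rwa [hxW] at this
    simp only [map_smul, _root_.smul_apply, smul_eq_mul, mul_zero, zero_smul, add_zero, one_mul] at h
    -- `h : J·D[T][T][ν] + (k B[ν][ν] − k B[T][T]) = 0`
    have hsw : fderiv ℝ (fderiv ℝ (fderiv ℝ θ)) x T T ν = fderiv ℝ (fderiv ℝ (fderiv ℝ θ)) x ν T T := by
      rw [fderiv3_swap23 hθ3 x T T ν, fderiv3_swap12 hθ3 x T ν T]
    simp only [hB, hD, hTdef, hνdef, hp_def, hJdef] at hTT0 hsw h ⊢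
    linear_combination h - (1 - k s * d z) * hsw + k s * hTT0
  /- (3) `∂_z` of `∂_νθ(W) = 0`, once (on the region) and twice (at the point). -/
  have hI1z : ∀ q ∈ region I, (fun q : ℝ × ℝ => deriv d q.2 *
      fderiv ℝ (fderiv ℝ θ) (Γ q.1 + Gd q • rotJ (deriv Γ q.1) + q.2 • e2) (rotJ (deriv Γ q.1)) (rotJ (deriv Γ q.1)) +
        fderiv ℝ (fderiv ℝ θ) (Γ q.1 + Gd q • rotJ (deriv Γ q.1) + q.2 • e2) e2 (rotJ (deriv Γ q.1))) q = 0 := by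
    intro q hq
    have h := fderiv_eq_zero_of_eqOn_region hI hνW hq (0, 1)
    rw [fderiv_moving_deriv hΓ hpl hk (hGdd q hq) hθ2 (hNd q.1), hGd_fd q hq] at h
    simp only [map_add, map_smul, _root_.add_apply, _root_.smul_apply, smul_eq_mul, zero_mul, zero_smul, zero_add,
      mul_one, one_smul] at h
    simp only
    linear_combination h
  have hE3 : deriv (deriv d) z * B ν ν + deriv d z * (deriv d z * D ν ν ν + D e2 ν ν) + (deriv d z * D ν e2 ν + D e2 e2 ν) = 0 := by
    have h := fderiv_eq_zero_of_eqOn_region hI hI1z hp (0, 1)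
    have hm1 : DifferentiableAt ℝ (fun q : ℝ × ℝ =>
        fderiv ℝ (fderiv ℝ θ) (Γ q.1 + Gd q • rotJ (deriv Γ q.1) + q.2 • e2) (rotJ (deriv Γ q.1)) (rotJ (deriv Γ q.1))) p :=
      differentiableAt_moving_hessian hΓ hpl hk (hGdd p hp) hθ3 (hNd p.1) (hNd p.1)
    have hm2 : DifferentiableAt ℝ (fun q : ℝ × ℝ =>
        fderiv ℝ (fderiv ℝ θ) (Γ q.1 + Gd q • rotJ (deriv Γ q.1) + q.2 • e2) e2 (rotJ (deriv Γ q.1))) p :=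
      differentiableAt_moving_hessian hΓ hpl hk (hGdd p hp) hθ3 (V₁ := fun _ => e2) (V₁' := 0) (hasDerivAt_const p.1 e2) (hNd p.1)
    rw [fderiv_fun_add ((hd'q p hp).differentiableAt.fun_mul hm1) hm2, fderiv_fun_mul (hd'q p hp).differentiableAt hm1] at h
    simp only [_root_.add_apply, _root_.smul_apply, smul_eq_mul] at h
    rw [(hd'q p hp).fderiv, fderiv_moving_hessian hΓ hpl hk (hGdd p hp) hθ3 (hNd p.1) (hNd p.1),
      fderiv_moving_hessian hΓ hpl hk (hGdd p hp) hθ3 (V₁ := fun _ => e2) (V₁' := 0) (hasDerivAt_const p.1 e2) (hNd p.1),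
      hGd_fd p hp, hxW] at h
    simp only [ContinuousLinearMap.comp_apply, ContinuousLinearMap.coe_snd', ContinuousLinearMap.smulRight_apply,
      ContinuousLinearMap.one_def, ContinuousLinearMap.id_apply, smul_eq_mul, map_add, map_smul, map_zero,
      _root_.add_apply, _root_.smul_apply, _root_.zero_apply, zero_mul, zero_smul, zero_add, mul_one, one_smul,
      add_zero] at h
    simp only [hB, hD, hνdef, hp_def] at h ⊢
    linear_combination h
  /- (4) the derivative of `a(z') = D²θ(W(s,z'))[ν,ν]` along the height. -/
  set α : ℝ → ℝ := fun z' => fderiv ℝ (fderiv ℝ θ) (Γ s + d z' • rotJ (deriv Γ s) + z' • e2) (rotJ (deriv Γ s)) (rotJ (deriv Γ s))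
    with hα_def
  have hline : HasDerivAt (fun z' : ℝ => Γ s + d z' • rotJ (deriv Γ s) + z' • e2) (deriv d z • ν + e2) z := by
    have h := (((hdd z hz).hasDerivAt.smul_const (rotJ (deriv Γ s))).const_add (Γ s)).fun_add ((hasDerivAt_id' z).smul_const e2)
    rw [one_smul] at h
    exact h
  have hα : HasDerivAt α (deriv d z * D ν ν ν + D e2 ν ν) z := by
    have hc := (hD2 x).hasFDerivAt.comp_hasDerivAt z hline
    have h := (hc.clm_apply (hasDerivAt_const z ν)).clm_apply (hasDerivAt_const z ν)
    refine h.congr_deriv ?_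
    simp [hD, hνdef, map_add, map_smul]
  /- (5) `∂_ν` of the slice law at the point + frame invariance. -/
  have hL1 : D ν e2 e2 + μ z * (D ν T T + D ν ν ν) = 0 := by
    -- the slice law in Hessian form on the open slab
    set S : EuclideanSpace ℝ (Fin 3) → ℝ := fun y => fderiv ℝ (fderiv ℝ θ) y e2 e2 +
      μ (y 2) * (fderiv ℝ (fderiv ℝ θ) y e0 e0 + fderiv ℝ (fderiv ℝ θ) y e1 e1) with hS
    have hSO : IsOpen {y : EuclideanSpace ℝ (Fin 3) | y 2 ∈ I} := hI.preimage (EuclideanSpace.proj (𝕜 := ℝ) (2 : Fin 3)).continuous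
    have hS0 : ∀ y ∈ {y : EuclideanSpace ℝ (Fin 3) | y 2 ∈ I}, S y = 0 := by
      intro y hy
      have h := hlaw y hy
      rw [nested_eq_fderiv_fderiv hθ2, nested_eq_fderiv_fderiv hθ2, nested_eq_fderiv_fderiv hθ2] at h
      simp only [hS, e0, e1, e2]
      linear_combination h
    have hx2 : x 2 = z := by simp [hx, hνdef, hpl, hν2s s, e2]
    have hxmem : x ∈ {y : EuclideanSpace ℝ (Fin 3) | y 2 ∈ I} := by show x 2 ∈ I; rw [hx2]; exact hz
    have hev : S =ᶠ[𝓝 x] fun _ => 0 := Filter.eventuallyEq_of_mem (hSO.mem_nhds hxmem) fun y hy => hS0 y hy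
    have hSfd : fderiv ℝ S x ν = 0 := by rw [hev.fderiv_eq]; simp
    -- compute `fderiv S x ν`
    have hμy : HasFDerivAt (fun y : EuclideanSpace ℝ (Fin 3) => μ (y 2))
        ((ContinuousLinearMap.smulRight (1 : ℝ →L[ℝ] ℝ) (deriv μ z)).comp (EuclideanSpace.proj (𝕜 := ℝ) (2 : Fin 3))) x := by
      have h1 : HasDerivAt μ (deriv μ z) (x 2) := by rw [hx2]; exact (hμ z hz).hasDerivAt
      exact h1.hasFDerivAt.comp x (EuclideanSpace.proj (𝕜 := ℝ) (2 : Fin 3)).hasFDerivAt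
    have hBc : ∀ a b : EuclideanSpace ℝ (Fin 3), HasFDerivAt (fun y => fderiv ℝ (fderiv ℝ θ) y a b)
        (fderiv ℝ (fun y => fderiv ℝ (fderiv ℝ θ) y a b) x) x := fun a b =>
      (((hD2 x).clm_apply (differentiableAt_const a)).clm_apply (differentiableAt_const b)).hasFDerivAt
    have hS' := (hBc e2 e2).add (hμy.mul ((hBc e0 e0).add (hBc e1 e1)))
    have hS'' : HasFDerivAt S _ x := hS'
    rw [hS''.fderiv] at hSfd
    simp only [_root_.add_apply, _root_.smul_apply, smul_eq_mul, ContinuousLinearMap.comp_apply,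
      ContinuousLinearMap.smulRight_apply, ContinuousLinearMap.one_def, ContinuousLinearMap.id_apply,
      fderiv_hessian_apply_const hθ3, Pi.add_apply] at hSfd
    have hν2 : (EuclideanSpace.proj (𝕜 := ℝ) (2 : Fin 3)) ν = 0 := hν2s s
    rw [hν2, hx2] at hSfd
    have hft := frame_trace (D ν) (hT2s s) (hun s)
    simp only [mul_zero, zero_mul, add_zero] at hSfd
    simp only [hD, hTdef, hνdef] at hft hSfd ⊢
    linear_combination hSfd + μ z * hft
  /- (6) assemble: the conserved quantity. -/
  have hQ := hQ0 z hz
  have hsw1 : D ν e2 ν = D e2 ν ν := by rw [hD, fderiv3_swap12 hθ3]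
  have hsw2 : D e2 e2 ν = D ν e2 e2 := by rw [hD, fderiv3_swap23 hθ3 x e2 e2 ν, fderiv3_swap12 hθ3 x e2 ν e2]
  rw [hsw1, hsw2] at hE3
  -- the derivative of the product
  have hdz : HasDerivAt d (deriv d z) z := (hdd z hz).hasDerivAt
  have hd'z : HasDerivAt (deriv d) (deriv (deriv d) z) z := (hdd1 z hz).hasDerivAt
  have hJ' : HasDerivAt (fun z' => 1 - k s * d z') (0 - k s * deriv d z) z :=
    (hasDerivAt_const z (1 : ℝ)).fun_sub (hdz.const_mul (k s))
  have hC := (hJ'.fun_mul hd'z).fun_mul (hα.fun_mul hα)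
  have hαz : α z = B ν ν := by simp [hα_def, hB, hx, hνdef]
  refine (hC.congr_deriv ?_).congr_of_eventuallyEq (Filter.Eventually.of_forall fun z' => by simp only [hα_def]; ring)
  rw [hαz]
  rw [hJdef] at hE1
  linear_combination ((1 - k s * d z) * B ν ν) * hE3 - ((1 - k s * d z) * B ν ν) * hL1 + (μ z * B ν ν) * hE1 +
    ((1 - k s * d z) * B ν ν * D ν ν ν - k s * B ν ν ^ 2) * hQ

end Summit.NavierStokesRegularity.NavierStokesRegularity.Theorems.PoloidalWindowDoorLrcModEntireCurvedSheetTransport
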